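import Summits.NavierStokesRegularity.NavierStokesRegularity.Theorems.SoloRefuteTennant2025
import Literature.Barriers.NavierStokesRegularity.SmallDataGlobalRegularity
import Literature.Analysis.FluidPDE.ClassicalSolutionRescale
import Literature.Analysis.FluidPDE.NSLerayHopf
import Literature.Analysis.FluidPDE.NSLerayHopfSereginEnergyProofs
import Literature.Analysis.FluidPDE.RapidDecayLemmas
import HarnessLib

/-!
# C89 `Tennant2025` — ADDENDUM face (d): Theorem 2.5 / (4.2)–(4.3) p.8 along genuine smooth solutions
# (`Step_Thm25`, `Step_43`) fail on the Navier–Stokes dilates of one small-data Clay solution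

Cell `ns-claims` (D-0090), claim C89, ADJUDICATED #113 (locator `Step_A6` = (A.6) p.14, kill `not_Step_A6`
p495634, refuter-6 g0; skeleton `Literature.Claims.NS.Tennant2025` p492873 + rev 2 p501169, typist-2).
Text of record: W. Tennant, *Global Regularity of 3D Navier–Stokes: Helical Null-Form, Coifman–Meyer
Estimate, and Compactness–Rigidity Closure in Ḃ^{1/2}_{2,1}*, figshare 30045250 v4 (2025) [Tennant2025].
PROVED: `not_Step_43 : ¬ Step_43` (Step 9, (4.3) p.8 l.22–30 «In particular, for any 0 ≤ t₀ < T,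
∫_{t₀}^T ‖u(t)‖²_H dt ≤ M(t₀)/(c₀ν)») and `not_Step_Thm25 : ¬ Step_Thm25` (Step 8, Thm 2.5 p.6 l.13–22
= (4.2) p.8 l.16–21, the differential inequality along solutions). The VERDICT of record lists Steps
8–9 as «downstream as printed, on paper false by NS scaling»; this companion, built on the refuter's
landed dilation calculus `Theorems/SoloRefuteTennant2025.lean`, decides them in the kernel.
MECHANISM (the NS scaling only): Gavrilov's compactly supported divergence-free `v ≠ 0` (a non-zero
Littlewood–Paley block `i₀`, tree `exists_testField_block_ne_zero`), `w₀ = ε v` with a global smooth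
bounded-energy solution `(U, P)` of the unforced system at `ν = 1` (tree `exists_clayA_smul`, Kato's
small-data theorem), and its dilates `u_k(t, x) = 2^k U(4^k t, 2^k x)` (classical solutions with data
`2^k w₀(2^k ·)`, tree `IsClassicalNSSolutionOn.nsRescale_holds`). EXACTLY `M(2^k w₀(2^k ·)) = 2^k M(w₀)`
(`morawetzM_nsDil`, degree one), while `∫₀^{4^{-k}} ‖u_k(t)‖²_H dt ≥ log 2 · 2^{3i} ∫₀¹ ‖Δ_i U(s)‖²₂ ds`
for every block `i` (`hNormE_smul`, the refuter's `hNormE_dil_ge`, `s = 4^k t`): degree zero. Some block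
has `∫₀¹ ‖Δ_i U(s)‖²₂ ds > 0` (else `U(s) = 0` for a.e. `s ∈ (0,1)` by `‖v‖²₂ ≤ 2Σ_j‖Δ_j v‖²₂`, and
`w₀ = 0` by continuity at `t = 0`), so `k → −∞` contradicts (4.3) with `t₀ = 0`, `T = 4^{-k}`, for
every admissible `(a, b, λ)` and every `c₀ > 0`. Step 8 needs no time integral: at `t = 0` the one-sided
derivative of `M` along `u_k` within `[0, T)` is `8^k M'(0)` (chain rule + uniqueness of derivatives
within `[0, T)`), `‖u_k(0)‖²_H ≥ 4^k · log 2 · 2^{3i₀}‖Δ_{i₀}w₀‖²₂` with `‖w₀‖_H < ∞` from the display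
itself, and `(c₀/2)·4^k β ≤ −8^k M'(0)` fails as `k → −∞`. Axioms `propext`, `Classical.choice`,
`Quot.sound`.

WHAT THIS IS NOT: not a claim about NS regularity or blow-up; not a claim about any author beyond the
typed locator.
-/

-- The summit's canonical theorem namespace repeats the summit name (single-conjunct summit).
set_option linter.dupNamespace false
noncomputable section
open Set Function MeasureTheory Filter Topology
open scoped ContDiff RealInnerProductSpace ENNReal NNReal

namespace Summit.NavierStokesRegularity.NavierStokesRegularity.Theorems.Tennant2025

open Literature.Analysis.FunctionSpaces Literature.Analysis.FluidPDE Literature.Claims.NS.Tennant2025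
open Literature.Barriers.NavierStokesRegularity
/-! ## Amplitudes `v ↦ c • v` (the NS dilation is `2^k • dil k`) -/
/-- Test fields are closed under constant multiples. -/
theorem isTestField_smul (c : ℝ) {v : E3 → E3} (hv : IsTestField v) : IsTestField (c • v) := by
  obtain ⟨h1, h2, h3⟩ := hv
  refine ⟨h1.const_smul c, h2.mono (support_const_smul_subset c v), fun x => ?_⟩
  have := h3 x
  unfold NSWave0.divergence at this ⊢
  rw [fderiv_const_smul_field, Pi.smul_apply, ContinuousLinearMap.toLinearMap_smul, map_smul, this,
    smul_zero]

/-- `‖Δ_j(c v)‖²₂ = c² ‖Δ_j v‖²₂`. -/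
theorem blockL2E_smul (j : ℤ) (c : ℝ) (v : E3 → E3) :
    blockL2E j (c • v) = ENNReal.ofReal (c ^ 2) * blockL2E j v := by
  unfold blockL2E
  rw [blockFn_smul]
  have h : ∀ x, ‖(c • blockFn j v) x‖ₑ ^ 2 = ENNReal.ofReal (c ^ 2) * ‖blockFn j v x‖ₑ ^ 2 := by
    intro x
    rw [Pi.smul_apply, enorm_smul, mul_pow, ← ofReal_norm c,
      ← ENNReal.ofReal_pow (norm_nonneg _), Real.norm_eq_abs, sq_abs]
  simp_rw [h]
  exact lintegral_const_mul' _ _ ENNReal.ofReal_ne_top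

/-- `‖c v‖²_H = c² ‖v‖²_H`. -/
theorem hNormE_smul (c : ℝ) (v : E3 → E3) :
    hNormE (c • v) = ENNReal.ofReal (c ^ 2) * hNormE v := by
  unfold hNormE
  rw [← ENNReal.tsum_mul_left]
  refine tsum_congr fun j => ?_
  rw [blockL2E_smul, mul_left_comm]

/-- The block energy of the zero field vanishes. -/
theorem blockL2E_zero (j : ℤ) : blockL2E j (0 : E3 → E3) = 0 := by
  simp [blockL2E]
/-! ## The Morawetz functional is homogeneous of degree one under the NS dilation -/
/-- `‖Δ_j v‖²₂ = ⟨Δ_j v, Δ_j v⟩` (real-valued Bochner forms). -/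
theorem blockL2sq_eq_blockPair (j : ℤ) (v : E3 → E3) : blockL2sq j v = blockPair j v v := by
  unfold blockL2sq blockPair
  refine integral_congr_ae (Eventually.of_forall fun x => ?_)
  simp only [real_inner_self_eq_norm_sq]

/-- **Exact scaling of (2.1)/(A.2) under `v ↦ 2^k v(2^k ·)`**: `M(2^k v(2^k ·)) = 2^k M(v)`. -/
theorem morawetzM_nsDil (p : Params) (k : ℤ) (v : E3 → E3) :
    morawetzM p (dy k • dil k v) = dy k * morawetzM p v := by
  have hc : dy k ≠ 0 := (dyk_pos k).ne'
  unfold morawetzM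
  simp only [blockL2sq_eq_blockPair]
  rw [curl_const_smul', curl_dil, smul_smul]
  have e1 : (∑' j, dy j ^ 2 * blockPair j (dy k • dil k v) (dy k • dil k v)) =
      dy k * ∑' i, dy i ^ 2 * blockPair i v v := by
    rw [tsum_shift k, ← tsum_mul_left]
    refine tsum_congr fun i => ?_
    rw [blockPair_smul, blockPair_dil, add_sub_cancel_right, dy_add]
    field_simp
  have e2 : (∑' j, blockPair j ((dy k * dy k) • dil k (curl v)) ((dy k * dy k) • dil k (curl v))) =
      dy k * ∑' i, blockPair i (curl v) (curl v) := by
    rw [tsum_shift k, ← tsum_mul_left]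
    refine tsum_congr fun i => ?_
    rw [blockPair_smul, blockPair_dil, add_sub_cancel_right]
    field_simp
  have e3 : (∑' j, dy j * blockPair j (dy k • dil k v) ((dy k * dy k) • dil k (curl v))) =
      dy k * ∑' i, dy i * blockPair i v (curl v) := by
    rw [tsum_shift k, ← tsum_mul_left]
    refine tsum_congr fun i => ?_
    rw [blockPair_smul, blockPair_dil, add_sub_cancel_right, dy_add]
    field_simp
  rw [e1, e2, e3]
  ring
/-! ## The Navier–Stokes dilates of a classical solution on `[0, ∞)` -/
/-- The parabolic rescaling by `2^k` in this file's vocabulary: `(nsRescale 2^k U) t = 2^k • (U(4^k t))(2^k ·)`. -/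
theorem nsRescale_dy (k : ℤ) (U : ℝ → E3 → E3) (t : ℝ) :
    nsRescale (dy k) U t = dy k • dil k (U (dy k ^ 2 * t)) := by
  funext x; rfl

/-- The time half-line is invariant under `t ↦ c² t`. -/
theorem preimage_mul_sq_Ici {c : ℝ} (hc : 0 < c) :
    (fun t => c ^ 2 * t) ⁻¹' Ici (0 : ℝ) = Ici 0 := by
  ext t
  simp only [mem_preimage, mem_Ici]
  exact mul_nonneg_iff_of_pos_left (pow_pos hc 2)

/-- The dilate `(2^k U(4^k t, 2^k x), 4^k P(4^k t, 2^k x))` of a classical solution of the unforced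
system on `[0, ∞)` is a classical solution (same viscosity) on every `[0, T)`. -/
theorem isClassicalNSSolutionOn_nsRescale_Ico {ν : ℝ} {U : ℝ → E3 → E3} {P : ℝ → E3 → ℝ}
    (hU : IsClassicalNSSolutionOn (Ici 0) ν 0 U P) (k : ℤ) (T : ℝ) :
    IsClassicalNSSolutionOn (Ico 0 T) ν 0 (nsRescale (dy k) U) (nsRescalePressure (dy k) P) := by
  have h := IsClassicalNSSolutionOn.nsRescale_holds hU (dyk_pos k)
  rw [preimage_mul_sq_Ici (dyk_pos k), nsRescaleForce_zero] at h
  exact h.mono Ico_subset_Ici_self (uniqueDiffOn_Ico 0 T)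
/-! ## Time: the substitution `s = a t` and positivity of a block's time integral -/
/-- Linear change of variables in time for the lower integral over `(0, T/a)`, `a > 0`. -/
theorem setLIntegral_Ioo_comp_mul {a : ℝ} (ha : 0 < a) (T : ℝ) (G : ℝ → ℝ≥0∞) :
    ∫⁻ t in Ioo 0 (T / a), G (a * t) = ENNReal.ofReal a⁻¹ * ∫⁻ s in Ioo 0 T, G s := by
  have hind : ∀ t, (Ioo 0 (T / a)).indicator (fun t => G (a * t)) t = (Ioo 0 T).indicator G (a * t) := by
    intro t
    by_cases ht : t ∈ Ioo 0 (T / a)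
    · have h' : a * t ∈ Ioo 0 T := ⟨mul_pos ha ht.1, (lt_div_iff₀' ha).1 ht.2⟩
      rw [indicator_of_mem ht, indicator_of_mem h']
    · have h' : a * t ∉ Ioo 0 T := fun h =>
        ht ⟨(mul_pos_iff_of_pos_left ha).1 h.1, (lt_div_iff₀' ha).2 h.2⟩
      rw [indicator_of_notMem ht, indicator_of_notMem h']
  rw [← lintegral_indicator measurableSet_Ioo, ← lintegral_indicator measurableSet_Ioo]
  simp_rw [hind]
  have h := lintegral_map_equiv ((Ioo 0 T).indicator G)
    (Homeomorph.mulLeft₀ a ha.ne').toMeasurableEquiv (μ := volume)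
  have he : ((Homeomorph.mulLeft₀ a ha.ne').toMeasurableEquiv : ℝ → ℝ) = fun x => a * x := rfl
  rw [he] at h
  simp only at h
  rw [← h, Real.map_volume_mul_left ha.ne', lintegral_smul_measure, abs_of_pos (inv_pos.2 ha),
    smul_eq_mul]

/-- For a field jointly smooth on `[0, ∞) × ℝ³`, the block energies of the slices (clamped at
`t = 0`) are measurable in time: Tonelli measurability of a continuous parametric convolution. -/
theorem measurable_blockL2E_slice {U : ℝ → E3 → E3} (hU : IsSmoothSpaceTimeOn (Ici 0) U) (i : ℤ) :
    Measurable fun s : ℝ => blockL2E i (U (max s 0)) := by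
  have hcont : Continuous fun q : (ℝ × E3) × E3 =>
      blockKernel E3 i q.2 • U (max q.1.1 0) (q.1.2 - q.2) := by
    refine ((continuous_blockKernel i).comp continuous_snd).smul ?_
    have hg : Continuous fun q : (ℝ × E3) × E3 => (max q.1.1 0, q.1.2 - q.2) :=
      ((continuous_fst.comp continuous_fst).max continuous_const).prodMk
        ((continuous_snd.comp continuous_fst).sub continuous_snd)
    exact hU.continuousOn.comp_continuous hg fun q => mk_mem_prod (mem_Ici.2 (le_max_right _ _)) (mem_univ _)
  have hsm : StronglyMeasurable fun q : ℝ × E3 => blockFn i (U (max q.1 0)) q.2 := by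
    have heq : (fun q : ℝ × E3 => blockFn i (U (max q.1 0)) q.2) =
        fun q => ∫ t, blockKernel E3 i t • U (max q.1 0) (q.2 - t) := by
      funext q; exact blockFn_apply i _ _
    rw [heq]
    exact hcont.stronglyMeasurable.integral_prod_right'
  have hF : Measurable fun q : ℝ × E3 => ‖blockFn i (U (max q.1 0)) q.2‖ₑ ^ 2 :=
    hsm.measurable.enorm.pow_const 2
  exact hF.lintegral_prod_right'

/-- A continuous `L²` field all of whose Littlewood–Paley blocks vanish is zero
(`‖v‖²₂ ≤ 2 Σ_j ‖Δ_j v‖²₂`, tree `eLpNorm_sq_le_two_mul_tsum_eLpNorm_blockFn_sq`). -/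
theorem eq_zero_of_blockL2E_eq_zero {v : E3 → E3} (hvc : Continuous v) (hv : MemLp v 2 volume)
    (h : ∀ j : ℤ, blockL2E j v = 0) : v = 0 := by
  have hLP := eLpNorm_sq_le_two_mul_tsum_eLpNorm_blockFn_sq (E := E3) hv
  have hblock : ∀ j : ℤ, eLpNorm (blockFn j v) 2 volume = 0 := by
    intro j
    have h0 : blockFn j v =ᵐ[volume] 0 := by
      have hj := h j
      rw [blockL2E, lintegral_eq_zero_iff'
        ((aestronglyMeasurable_blockFn j hv.1).enorm.pow_const 2)] at hj
      filter_upwards [hj] with x hx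
      simpa using hx
    rw [eLpNorm_congr_ae h0, eLpNorm_zero]
  have hz : (∑' j : ℤ, eLpNorm (blockFn j v) 2 volume ^ 2) = 0 := by simp [hblock]
  rw [hz, mul_zero, nonpos_iff_eq_zero, pow_eq_zero_iff two_ne_zero] at hLP
  exact (hvc.ae_eq_iff_eq volume continuous_const).1 ((eLpNorm_eq_zero_iff hv.1 two_ne_zero).1 hLP)

/-- Bounded energy and continuity put a slice in `L²`. -/
theorem memLp_two_of_hasBoundedEnergy {U : ℝ → E3 → E3} (hE : HasBoundedEnergy U) {s : ℝ}
    (hs : 0 ≤ s) (hc : Continuous (U s)) : MemLp (U s) 2 volume := by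
  obtain ⟨C, hC, hb⟩ := hE
  have h2 : ∫⁻ x, ‖U s x‖ₑ ^ 2 < ⊤ := (hb s hs).trans_lt hC
  refine ⟨hc.aestronglyMeasurable, ?_⟩
  rw [eLpNorm_lt_top_iff_lintegral_rpow_enorm_lt_top two_ne_zero ENNReal.ofNat_ne_top]
  simpa [ENNReal.rpow_two] using h2

/-- **Positivity in time.** For a bounded-energy field jointly smooth on `[0, ∞) × ℝ³` with
`U(0) ≠ 0`, some block has `∫₀¹ ‖Δ_i U(s)‖²₂ ds > 0`: otherwise every block of `U(s)` vanishes for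
a.e. `s ∈ (0, 1)`, so `U(s) = 0` there, and continuity at `t = 0` gives `U(0) = 0`. -/
theorem exists_setLIntegral_blockL2E_ne_zero {U : ℝ → E3 → E3} (hU : IsSmoothSpaceTimeOn (Ici 0) U)
    (hE : HasBoundedEnergy U) (h0 : U 0 ≠ 0) :
    ∃ i : ℤ, (∫⁻ s in Ioo 0 1, blockL2E i (U s)) ≠ 0 := by
  by_contra! h
  have hae : ∀ᵐ s ∂(volume.restrict (Ioo (0 : ℝ) 1)), ∀ i : ℤ, blockL2E i (U s) = 0 := by
    rw [ae_all_iff]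
    intro i
    have h1 : ∫⁻ s in Ioo (0 : ℝ) 1, blockL2E i (U (max s 0)) = 0 := by
      rw [← h i]
      exact setLIntegral_congr_fun measurableSet_Ioo fun s hs => by rw [max_eq_left hs.1.le]
    have h2 := (lintegral_eq_zero_iff (measurable_blockL2E_slice hU i)).1 h1
    filter_upwards [h2, ae_restrict_mem measurableSet_Ioo] with s hs hs'
    rw [Pi.zero_apply, max_eq_left hs'.1.le] at hs
    exact hs
  have hzero : ∀ᵐ s ∂(volume.restrict (Ioo (0 : ℝ) 1)), U s = 0 := by
    filter_upwards [hae, ae_restrict_mem measurableSet_Ioo] with s hs hs'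
    have hsc : Continuous (U s) := hU.continuous_slice (mem_Ici.2 hs'.1.le)
    exact eq_zero_of_blockL2E_eq_zero hsc (memLp_two_of_hasBoundedEnergy hE hs'.1.le hsc) hs
  obtain ⟨x₀, hx₀⟩ : ∃ x₀, U 0 x₀ ≠ 0 := by
    by_contra! h'
    exact h0 (funext h')
  have hcont : ContinuousWithinAt (fun s => U s x₀) (Ici 0) 0 :=
    hU.continuousWithinAt_time (mem_Ici.2 le_rfl) x₀
  obtain ⟨η, hη, hnear⟩ := Metric.continuousWithinAt_iff.1 hcont ‖U 0 x₀‖ (norm_pos_iff.2 hx₀)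
  set m : ℝ := min η 1 with hm
  have hm0 : 0 < m := lt_min hη one_pos
  have hsub : Ioo (0 : ℝ) m ⊆ Ioo 0 1 := Ioo_subset_Ioo le_rfl (min_le_right _ _)
  have h1 : ∀ᵐ s ∂(volume.restrict (Ioo (0 : ℝ) m)), U s = 0 :=
    ae_restrict_of_ae_restrict_of_subset hsub hzero
  have h2 : ∀ᵐ s ∂(volume.restrict (Ioo (0 : ℝ) m)), s ∈ Ioo (0 : ℝ) m :=
    ae_restrict_mem measurableSet_Ioo
  haveI : (ae (volume.restrict (Ioo (0 : ℝ) m))).NeBot := by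
    rw [ae_neBot, Ne, Measure.restrict_eq_zero, Real.volume_Ioo, sub_zero, ENNReal.ofReal_eq_zero,
      not_le]
    exact hm0
  obtain ⟨s, hs0, hsm⟩ := (h1.and h2).exists
  have hlt : dist (U s x₀) (U 0 x₀) < ‖U 0 x₀‖ :=
    hnear (mem_Ici.2 hsm.1.le) (by
      rw [dist_zero_right, Real.norm_eq_abs, abs_of_pos hsm.1]
      exact hsm.2.trans_le (min_le_left _ _))
  rw [hs0, Pi.zero_apply, dist_comm, dist_zero_right] at hlt
  exact lt_irrefl _ hlt
/-! ## The refutation of (4.3) -/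
/-- **`¬ Step_43`** ((4.3) p.8 l.22–30 along genuine solutions): the Navier–Stokes dilates
`2^k U(4^k t, 2^k x)`, `k → −∞`, of ONE global smooth bounded-energy solution `U` of the unforced
system with small compactly supported datum violate `∫_{0}^{T} ‖u‖²_H dt ≤ M(0)/(c₀ν)` at `ν = 1`,
`T = 4^{-k}`: the left side does not scale, the right side carries the factor `2^k`. -/
theorem not_Step_43 : ¬ Literature.Claims.NS.Tennant2025.Step_43 := by
  intro h
  obtain ⟨p, -, c₀, hc₀, h43⟩ := h 1 one_pos
  obtain ⟨v, hv, i₀, hi₀⟩ := exists_testField_block_ne_zero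
  obtain ⟨ε, hε, hsol⟩ := exists_clayA_smul one_pos hv.1 hv.2.2
    (HasRapidSpatialDecay.of_hasCompactSupport hv.1 hv.2.1)
  obtain ⟨U, P, hUs, hPs, hns, hE⟩ := hsol ε (abs_of_pos hε).le
  have hw₀t : IsTestField (ε • v) := isTestField_smul ε hv
  have hBw : blockL2E i₀ (ε • v) ≠ 0 := by
    rw [blockL2E_smul]
    exact mul_ne_zero (by rw [Ne, ENNReal.ofReal_eq_zero, not_le]; positivity) hi₀
  have hw0 : (ε • v) ≠ 0 := fun h0 => hBw (by rw [h0, blockL2E_zero])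
  obtain ⟨hcl, hU0⟩ := isNavierStokesSolution_and_smooth_iff.1 ⟨hns, hUs, hPs⟩
  obtain ⟨i, hQ⟩ := exists_setLIntegral_blockL2E_ne_zero hcl.smooth_velocity hE (by rwa [hU0])
  have hL : 0 < Real.log 2 * dy i ^ 3 := by
    have := dyk_pos i; have := Real.log_pos one_lt_two; positivity
  refine no_uniform_bound hL hQ (morawetzM p (ε • v) / c₀) fun k => ?_
  have hc : 0 < dy k := dyk_pos k
  have hT : 0 < 1 / dy k ^ 2 := by positivity
  have hz := isClassicalNSSolutionOn_nsRescale_Ico hcl k (1 / dy k ^ 2)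
  have hz0 : nsRescale (dy k) U 0 = dy k • dil k (ε • v) := by rw [nsRescale_dy, mul_zero, hU0]
  have key := h43 (dy k • dil k (ε • v)) (isTestField_smul (dy k) (isTestField_dil k hw₀t))
    (1 / dy k ^ 2) hT (nsRescale (dy k) U) (nsRescalePressure (dy k) P) hz hz0 0 (left_mem_Ico.2 hT)
  rw [hz0, morawetzM_nsDil, mul_one] at key
  have hpt : ∀ t : ℝ, ENNReal.ofReal (dy k ^ 2 * (Real.log 2 * dy i ^ 3)) * blockL2E i (U (dy k ^ 2 * t))
      ≤ hNormE (nsRescale (dy k) U t) := by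
    intro t
    rw [nsRescale_dy, hNormE_smul, ENNReal.ofReal_mul (sq_nonneg _), mul_assoc]
    exact mul_le_mul_right (hNormE_dil_ge i k _) _
  have haux : ENNReal.ofReal (dy k ^ 2 * (Real.log 2 * dy i ^ 3)) * ENNReal.ofReal (dy k ^ 2)⁻¹ =
      ENNReal.ofReal (Real.log 2 * dy i ^ 3) := by
    rw [← ENNReal.ofReal_mul (by positivity)]
    congr 1
    field_simp
  calc ENNReal.ofReal (Real.log 2 * dy i ^ 3) * ∫⁻ s in Ioo 0 1, blockL2E i (U s)
      = ENNReal.ofReal (dy k ^ 2 * (Real.log 2 * dy i ^ 3)) *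
          (ENNReal.ofReal (dy k ^ 2)⁻¹ * ∫⁻ s in Ioo 0 1, blockL2E i (U s)) := by
        rw [← mul_assoc, haux]
    _ = ENNReal.ofReal (dy k ^ 2 * (Real.log 2 * dy i ^ 3)) *
          ∫⁻ t in Ioo 0 (1 / dy k ^ 2), blockL2E i (U (dy k ^ 2 * t)) := by
        rw [setLIntegral_Ioo_comp_mul (pow_pos hc 2) 1 (fun s => blockL2E i (U s))]
    _ ≤ ∫⁻ t in Ioo 0 (1 / dy k ^ 2),
          ENNReal.ofReal (dy k ^ 2 * (Real.log 2 * dy i ^ 3)) * blockL2E i (U (dy k ^ 2 * t)) :=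
        lintegral_const_mul_le _ _
    _ ≤ ∫⁻ t in Ioo 0 (1 / dy k ^ 2), hNormE (nsRescale (dy k) U t) := lintegral_mono fun t => hpt t
    _ ≤ ENNReal.ofReal (dy k * morawetzM p (ε • v) / c₀) := key
    _ ≤ ENNReal.ofReal (dy k * |morawetzM p (ε • v) / c₀|) := ENNReal.ofReal_le_ofReal (by
        rw [mul_div_assoc]; exact mul_le_mul_of_nonneg_left (le_abs_self _) hc.le)
/-! ## The refutation of the differential form (4.2) / Theorem 2.5 along solutions -/
/-- `dil 0` is the identity. -/
theorem dil_zero (w : E3 → E3) : dil 0 w = w := by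
  funext x; simp [dil, dy]

/-- **`¬ Step_Thm25`** (Theorem 2.5 p.6 l.13–22 = (4.2) p.8 along genuine solutions, Step 8 of the
skeleton): at `t = 0` the printed inequality `dM/dt + (c₀/2) ν ‖u‖²_H ≤ 0` for the dilates
`2^k U(4^k t, 2^k x)` reads `8^k M'(0) + (c₀/2) 4^k ‖(dil_k w₀)‖²_H ≤ 0` (the one-sided derivative
within `[0, T)` is unique, `M` has degree one and time degree two), while
`‖dil_k w₀‖²_H ≥ log 2 · 2^{3 i₀} ‖Δ_{i₀} w₀‖²₂ > 0`: divide by `4^k` and let `k → −∞`. -/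
theorem not_Step_Thm25 : ¬ Literature.Claims.NS.Tennant2025.Step_Thm25 := by
  intro h
  obtain ⟨p, -, c₀, hc₀, h25⟩ := h 1 one_pos
  obtain ⟨v, hv, i₀, hi₀⟩ := exists_testField_block_ne_zero
  obtain ⟨ε, hε, hsol⟩ := exists_clayA_smul one_pos hv.1 hv.2.2
    (HasRapidSpatialDecay.of_hasCompactSupport hv.1 hv.2.1)
  obtain ⟨U, P, hUs, hPs, hns, -⟩ := hsol ε (abs_of_pos hε).le
  have hw₀t : IsTestField (ε • v) := isTestField_smul ε hv
  have hBw : blockL2E i₀ (ε • v) ≠ 0 := by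
    rw [blockL2E_smul]
    exact mul_ne_zero (by rw [Ne, ENNReal.ofReal_eq_zero, not_le]; positivity) hi₀
  obtain ⟨hcl, hU0⟩ := isNavierStokesSolution_and_smooth_iff.1 ⟨hns, hUs, hPs⟩
  -- the solution itself on `[0, 1)`: finiteness of `‖w₀‖_H` and the base derivative `M'(0)`
  obtain ⟨hfin0, M₀, hg, -⟩ := h25 (ε • v) hw₀t 1 one_pos U P
    (hcl.mono Ico_subset_Ici_self (uniqueDiffOn_Ico 0 1)) hU0 0 (left_mem_Ico.2 one_pos)
  have hL : 0 < Real.log 2 * dy i₀ ^ 3 := by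
    have := dyk_pos i₀; have := Real.log_pos one_lt_two; positivity
  have hLB : ENNReal.ofReal (Real.log 2 * dy i₀ ^ 3) * blockL2E i₀ (ε • v) < ⊤ :=
    calc ENNReal.ofReal (Real.log 2 * dy i₀ ^ 3) * blockL2E i₀ (ε • v)
        ≤ hNormE (dil 0 (ε • v)) := hNormE_dil_ge i₀ 0 _
      _ = hNormE (U 0) := by rw [dil_zero, hU0]
      _ < ⊤ := hfin0
  obtain ⟨β, hβdef⟩ : ∃ β : ℝ,
      β = (ENNReal.ofReal (Real.log 2 * dy i₀ ^ 3) * blockL2E i₀ (ε • v)).toReal := ⟨_, rfl⟩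
  have hβ : 0 < β := by
    rw [hβdef]
    exact ENNReal.toReal_pos
      (mul_ne_zero (by rw [Ne, ENNReal.ofReal_eq_zero, not_le]; exact hL) hBw) hLB.ne
  refine no_uniform_bound (half_pos hc₀)
    (show ENNReal.ofReal β ≠ 0 by rw [Ne, ENNReal.ofReal_eq_zero, not_le]; exact hβ) M₀ fun k => ?_
  have hc : 0 < dy k := dyk_pos k
  have hT : 0 < 1 / dy k ^ 2 := by positivity
  have hz := isClassicalNSSolutionOn_nsRescale_Ico hcl k (1 / dy k ^ 2)
  have hz0 : nsRescale (dy k) U 0 = dy k • dil k (ε • v) := by rw [nsRescale_dy, mul_zero, hU0]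
  obtain ⟨hfink, Mk, hMk, hr⟩ := h25 (dy k • dil k (ε • v))
    (isTestField_smul (dy k) (isTestField_dil k hw₀t)) (1 / dy k ^ 2) hT (nsRescale (dy k) U)
    (nsRescalePressure (dy k) P) hz hz0 0 (left_mem_Ico.2 hT)
  -- chain rule: `M(u_k(s)) = 2^k M(U(4^k s))`, so `M_k'(0) = 8^k M'(0)` (one-sided derivatives
  -- within `[0, T)` are unique)
  have hlin : HasDerivWithinAt (fun s : ℝ => dy k ^ 2 * s) (dy k ^ 2) (Ico 0 (1 / dy k ^ 2)) 0 :=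
    ((hasDerivWithinAt_id (0 : ℝ) (Ico 0 (1 / dy k ^ 2))).const_mul (dy k ^ 2)).congr_deriv
      (mul_one _)
  have hmaps : MapsTo (fun s : ℝ => dy k ^ 2 * s) (Ico 0 (1 / dy k ^ 2)) (Ico 0 1) := fun s hs =>
    ⟨mul_nonneg (pow_pos hc 2).le hs.1, (lt_div_iff₀' (pow_pos hc 2)).1 hs.2⟩
  have hg' : HasDerivWithinAt (fun s => morawetzM p (U s)) M₀ (Ico 0 1) (dy k ^ 2 * 0) := by
    rw [mul_zero]; exact hg
  have hcomp := hg'.comp 0 hlin hmaps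
  have hfun : (fun s => morawetzM p (nsRescale (dy k) U s)) =
      fun s => dy k * ((fun s => morawetzM p (U s)) ∘ fun s => dy k ^ 2 * s) s := by
    funext s; rw [nsRescale_dy, morawetzM_nsDil]; rfl
  have hgk : HasDerivWithinAt (fun s => morawetzM p (nsRescale (dy k) U s)) (dy k * (M₀ * dy k ^ 2))
      (Ico 0 (1 / dy k ^ 2)) 0 := by
    rw [hfun]; exact hcomp.const_mul (dy k)
  have hud : UniqueDiffWithinAt ℝ (Ico 0 (1 / dy k ^ 2)) 0 :=
    uniqueDiffOn_Ico 0 _ 0 (left_mem_Ico.2 hT)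
  have hMk_eq : Mk = dy k * (M₀ * dy k ^ 2) := by rw [← hMk.derivWithin hud, hgk.derivWithin hud]
  -- the `H`-seminorm of the dilated datum: `4^k β ≤ ‖2^k (dil_k w₀)‖²_H`
  have hH : dy k ^ 2 * β ≤ (hNormE (nsRescale (dy k) U 0)).toReal := by
    have hle : ENNReal.ofReal (dy k ^ 2) *
        (ENNReal.ofReal (Real.log 2 * dy i₀ ^ 3) * blockL2E i₀ (ε • v)) ≤
        hNormE (nsRescale (dy k) U 0) := by
      rw [hz0, hNormE_smul]; exact mul_le_mul_right (hNormE_dil_ge i₀ k _) _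
    have := ENNReal.toReal_mono hfink.ne hle
    rwa [ENNReal.toReal_mul, ENNReal.toReal_ofReal (sq_nonneg _), ← hβdef] at this
  rw [hMk_eq, mul_one] at hr
  have h2 : c₀ / 2 * (dy k ^ 2 * β) ≤ c₀ / 2 * (hNormE (nsRescale (dy k) U 0)).toReal :=
    mul_le_mul_of_nonneg_left hH (by positivity)
  have habs : dy k ^ 3 * -M₀ ≤ dy k ^ 3 * |M₀| :=
    mul_le_mul_of_nonneg_left (neg_le_abs M₀) (pow_pos hc 3).le
  have h3 : dy k ^ 2 * (c₀ / 2 * β) ≤ dy k ^ 2 * (dy k * |M₀|) := by nlinarith [h2, hr, habs]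
  rw [← ENNReal.ofReal_mul (by positivity)]
  exact ENNReal.ofReal_le_ofReal (le_of_mul_le_mul_left h3 (pow_pos hc 2))

end Summit.NavierStokesRegularity.NavierStokesRegularity.Theorems.Tennant2025

end
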